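import Mathlib
import Summits.Ventures.HodgeRepro2.PeterssonNorm
import Summits.Ventures.HodgeRepro2.BallQuotientHolomorphicDescent

/-!
# The Petersson density descends to `Γ\𝔹²` and is bounded when the quotient is compact

Kernel annex of the blind cell `pub-hodge-repro2` (seat p2), Tier-3 hypothesis shapes of
`Hypothesis.lean`.  For a function `f` on the ball, continuous on the ball and transforming
as an automorphic form of weight `k` under (the image in `U(2,1)` of) a group `Γ ⊆ U(H)(K)`
(`f(γz) = j(γ,z)^k f(z)`), the Petersson density `|f|²(1 − ‖z‖²)^k` is `Γ`-invariant
(`PeterssonNorm.lean`), hence a continuous function on `Γ\𝔹²` (`peterssonQuotient`); if `Γ\𝔹²`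
is COMPACT (the arithmetic hypothesis of the transfer, anisotropic `H`), it is bounded
(**`exists_petersson_le_of_compactSpace`**) — the finiteness of the Petersson norm of every
automorphic form on a compact Picard modular surface, in the weakest form.
-/

namespace Summit.Ventures.HodgeRepro2.ShimuraData

open Topology

/-- `f` transforms as an automorphic form of weight `k` under the image of `S` in `U(2,1)`
through the frame `Q` at `τ₁`: `f(γz) = j(γ, z)^k f(z)` for `γ ∈ S`, `z` in the ball. -/
def IsWeightFor {K : Type*} [Field K] (τ₁ : K →+* ℂ) (Q : Matrix (Fin 3) (Fin 3) ℂ)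
    (S : Subgroup (GL (Fin 3) K)) (k : ℕ) (f : (Fin 2 → ℂ) → ℂ) : Prop :=
  ∀ γ ∈ S, ∀ z ∈ ball₂, f (ballAction (realEmbedding K τ₁ Q γ) z) =
    autFactor (realEmbedding K τ₁ Q γ) z ^ k * f z

variable {K : Type*} [Field K] [NumberField K] [NumberField.IsCMField K]
  {τ₁ : K →+* ℂ} {H : Matrix (Fin 3) (Fin 3) K} {Q : Matrix (Fin 3) (Fin 3) ℂ}
  (hQ : IsFrame K τ₁ H Q) (S : Subgroup (GL (Fin 3) K))
  (hS : (S : Set (GL (Fin 3) K)) ⊆ (unitaryGroup K H : Set (GL (Fin 3) K)))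

/-- `‖z‖²` is continuous. -/
theorem continuous_normSq₂ : Continuous normSq₂ :=
  ((continuous_apply 0).norm.pow 2).add ((continuous_apply 1).norm.pow 2)

/-- The Petersson density of a function continuous on the ball is continuous on the ball. -/
theorem continuousOn_petersson (k : ℕ) {f : (Fin 2 → ℂ) → ℂ} (hf : ContinuousOn f ball₂) :
    ContinuousOn (petersson k f) ball₂ :=
  (hf.norm.pow 2).mul ((continuous_const.sub continuous_normSq₂).pow k).continuousOn

/-- The Petersson density of a weight-`k` form for `S` is `S`-invariant on the ball (as a
function on the subtype `ball₂`, for the frame action). -/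
theorem petersson_frameAction_smul {k : ℕ} {f : (Fin 2 → ℂ) → ℂ} (hf : IsWeightFor τ₁ Q S k f) :
    letI := frameAction hQ S hS
    ∀ (γ : S) (z : ball₂), petersson k f (γ • z : ball₂) = petersson k f z := by
  letI := frameAction hQ S hS
  intro γ z
  rw [frameAction_smul_coe]
  exact petersson_ballAction (hQ.isInU21_realEmbedding (hS γ.2)) z.2 (hf γ γ.2 z z.2)

/-- The Petersson density of a weight-`k` form, as a function on `Γ\𝔹²`. -/
noncomputable def peterssonQuotient {k : ℕ} {f : (Fin 2 → ℂ) → ℂ} (hf : IsWeightFor τ₁ Q S k f) :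
    ballQuotient hQ S hS → ℝ :=
  ballQuotientLift hQ S hS (fun z : ball₂ => petersson k f z) (petersson_frameAction_smul hQ S hS hf)

/-- The descended Petersson density pulls back to the Petersson density. -/
@[simp]
theorem peterssonQuotient_mk {k : ℕ} {f : (Fin 2 → ℂ) → ℂ} (hf : IsWeightFor τ₁ Q S k f) (z : ball₂) :
    peterssonQuotient hQ S hS hf (ballQuotient.mk hQ S hS z) = petersson k f z :=
  rfl

/-- The descended Petersson density is continuous on `Γ\𝔹²` when `f` is continuous on the
ball. -/
theorem continuous_peterssonQuotient {k : ℕ} {f : (Fin 2 → ℂ) → ℂ} (hf : IsWeightFor τ₁ Q S k f)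
    (hfc : ContinuousOn f ball₂) : Continuous (peterssonQuotient hQ S hS hf) := by
  refine continuous_ballQuotientLift hQ S hS ?_ _
  exact (continuousOn_petersson k hfc).comp_continuous continuous_subtype_val fun z => z.2

/-- **On a compact `Γ\𝔹²` the Petersson density of every automorphic form is bounded**:
`|f(z)|² (1 − ‖z‖²)^k ≤ C` on the ball. -/
theorem exists_petersson_le_of_compactSpace [CompactSpace (ballQuotient hQ S hS)] {k : ℕ}
    {f : (Fin 2 → ℂ) → ℂ} (hf : IsWeightFor τ₁ Q S k f) (hfc : ContinuousOn f ball₂) :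
    ∃ C : ℝ, ∀ z ∈ ball₂, petersson k f z ≤ C := by
  obtain ⟨C, hC⟩ := (isCompact_univ.image (continuous_peterssonQuotient hQ S hS hf hfc)).bddAbove
  refine ⟨C, fun z hz => ?_⟩
  have := hC ⟨ballQuotient.mk hQ S hS ⟨z, hz⟩, Set.mem_univ _, rfl⟩
  simpa using this

/-- On a compact `Γ\𝔹²`, an automorphic form of weight `k` satisfies the growth bound
`|f(z)|² ≤ C / (1 − ‖z‖²)^k` on the ball. -/
theorem exists_normSq_le_of_compactSpace [CompactSpace (ballQuotient hQ S hS)] {k : ℕ}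
    {f : (Fin 2 → ℂ) → ℂ} (hf : IsWeightFor τ₁ Q S k f) (hfc : ContinuousOn f ball₂) :
    ∃ C : ℝ, ∀ z ∈ ball₂, ‖f z‖ ^ 2 ≤ C / (1 - normSq₂ z) ^ k := by
  obtain ⟨C, hC⟩ := exists_petersson_le_of_compactSpace hQ S hS hf hfc
  refine ⟨C, fun z hz => ?_⟩
  have hpos : 0 < (1 - normSq₂ z) ^ k := pow_pos (sub_pos.2 (normSq₂_lt_one hz)) k
  rw [le_div_iff₀ hpos]
  exact hC z hz

end Summit.Ventures.HodgeRepro2.ShimuraData
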